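import Summits.HubbardSuperconductivity.HubbardLadder.ClusterCutKernelBits
import Summits.HubbardSuperconductivity.HubbardLadder.Oct12Representation
import Summits.HubbardSuperconductivity.HubbardLadder.GroupAlgebraPieces
import HarnessLib

/-!
# Cluster pair-cuts, the oct12 SEAM: `16 • P_b e_σ` is the kernel's signed orbit sum

HONEST FRAMING: ladder R1–R4 with certified numbers; no claim on H/H₀.  Cell pub-hubbard, lane r2-eng-1 (g13); the (b)↔(c) interface
named in `pub-hubbard-r2-eng-1/psdcert-g12/C-SPEC-g12.md` §7 (c2) and r2 g43's INBOX l.5252 / l.5301.  Infrastructure; certifies no cell.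

For every integer coefficient table `a : Oct12Sym → ℤ` (`Oct12Sym = D₄ × Z₂`, GroupAlgebraPieces) the group-algebra operator
`algOp (oct12SymRep 2) (tableOfInt 16 a)` (Oct12Representation / GroupAlgebraPieces; with `a = oct12Table b` this is the symmetry piece
`oct12Piece b` of `Oct12It4RowOfH0`) satisfies `16 • (algOp … a/16) e_σ = colVec 12 (orbitVec 12 (oct12GList a) (code σ))` (`oct12_seam`), where
`oct12GList a` lists, for the sixteen group elements in the fixed order `oct12Elems`, the image table of the site permutation
(`permTable (oct12SitePerm g)`), the flip bit, and the coefficient `a g` — exactly the map-list format of the kernel's `orbitVec` / `spanOK`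
(ClusterCutSpan).  Ingredients: `natCast_smul_sum_table_mulVec` + `oct12SymRep_mulVec_single` (Oct12Representation §5) and
`actBits_encodeBits` (ClusterCutKernelBits).  All statements [folklore].
-/

namespace Summit.HubbardSuperconductivity.HubbardLadder.ClusterCut

open Matrix Literature.MathematicalPhysics.QuantumLattice

/-! ## The oct12 seam: `16 • P_b e_σ` is the kernel's signed orbit sum -/

section Oct12Seam

open Summit.HubbardSuperconductivity.HubbardLadder.PsdCert (ent)

/-- The sixteen elements of `Oct12Sym = D₄ × Z₂`, in the order used by the kernel map lists
(`r0, r1, r2, r3, sr0, sr1, sr2, sr3`, each without / with the global flip). [folklore] -/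
def oct12Elems : List Oct12Sym :=
  [(DihedralGroup.r 0, 1), (DihedralGroup.r 0, Multiplicative.ofAdd 1),
   (DihedralGroup.r 1, 1), (DihedralGroup.r 1, Multiplicative.ofAdd 1),
   (DihedralGroup.r 2, 1), (DihedralGroup.r 2, Multiplicative.ofAdd 1),
   (DihedralGroup.r 3, 1), (DihedralGroup.r 3, Multiplicative.ofAdd 1),
   (DihedralGroup.sr 0, 1), (DihedralGroup.sr 0, Multiplicative.ofAdd 1),
   (DihedralGroup.sr 1, 1), (DihedralGroup.sr 1, Multiplicative.ofAdd 1),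
   (DihedralGroup.sr 2, 1), (DihedralGroup.sr 2, Multiplicative.ofAdd 1),
   (DihedralGroup.sr 3, 1), (DihedralGroup.sr 3, Multiplicative.ofAdd 1)]

/-- The enumeration has no duplicates. [folklore] -/
theorem oct12Elems_nodup : oct12Elems.Nodup := by decide

/-- The enumeration is complete. [folklore] -/
theorem mem_oct12Elems (g : Oct12Sym) : g ∈ oct12Elems := by
  revert g; decide

/-- A sum over `Oct12Sym` is the list sum over the enumeration. [folklore] -/
theorem sum_eq_oct12Elems_sum {M : Type*} [AddCommMonoid M] (f : Oct12Sym → M) :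
    ∑ g, f g = (oct12Elems.map f).sum := by
  rw [← List.sum_toFinset f oct12Elems_nodup]
  exact Finset.sum_congr (by ext g; simp [mem_oct12Elems]) fun _ _ => rfl

/-- **The kernel map list of a coefficient table** `a : Oct12Sym → ℤ`: for each group element (in the order of `oct12Elems`) the image
table of its site permutation, the flip bit, and the coefficient. [folklore] -/
def oct12GList (a : Oct12Sym → ℤ) : List (List ℕ × Bool × ℤ) :=
  oct12Elems.map fun g => (permTable (oct12SitePerm g.1), !decide (g.2 = 1), a g)

/-- The basis action of `(g, ε) ∈ Oct12Sym` on a spin-½ configuration: relabel by the site permutation, then flip all spins iff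
`ε` is the generator. [folklore] -/
def oct12Act (g : Oct12Sym) (σ : Fin 12 → Fin 2) : Fin 12 → Fin 2 :=
  fun x => if (!decide (g.2 = 1)) then Fin.rev (σ ((oct12SitePerm g.1).symm x)) else σ ((oct12SitePerm g.1).symm x)

/-- `U (g, ε) e_σ = e_{(g,ε)·σ}` in terms of `oct12Act`. [folklore] -/
theorem oct12SymRep_mulVec_single_act (g : Oct12Sym) (σ : Fin 12 → Fin 2) :
    oct12SymRep 2 g *ᵥ Pi.single σ 1 = Pi.single (oct12Act g σ) 1 := by
  obtain ⟨g, ε⟩ := g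
  rw [oct12SymRep_mulVec_single]
  congr 1
  funext x
  unfold oct12Act
  rcases zmod2_cases ε with rfl | rfl
  · simp
  · rw [if_neg zmod2_gen_ne_one, flipCfgPerm_apply]
    simp

/-- The kernel's bitmask map of `(g, ε)` realises `oct12Act` on codes. [folklore] -/
theorem actBits_oct12 (g : Oct12Sym) (σ : Fin 12 → Fin 2) :
    actBits 12 (permTable (oct12SitePerm g.1)) (!decide (g.2 = 1)) (encodeBits σ) = encodeBits (oct12Act g σ) := by
  rw [actBits_encodeBits]
  rfl

/-- Codes are equal iff configurations are. [folklore] -/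
theorem encodeBits_inj {N : ℕ} {σ τ : Fin N → Fin 2} : encodeBits σ = encodeBits τ ↔ σ = τ :=
  ⟨fun h => by rw [← decodeBits_encodeBits σ, h, decodeBits_encodeBits], fun h => by rw [h]⟩

/-- **SEAM**: for every integer coefficient table `a` on `Oct12Sym`, sixteen times the group-algebra operator
`algOp U (a/16)` applied to a basis configuration is the kernel's signed orbit sum of its code:
`16 • (Σ_g (a g/16) • U g) e_σ = colVec (orbitVec 12 (oct12GList a) (code σ))`.  With `a = oct12Table b` the left side is
`16 • oct12Piece b e_σ`. [folklore] -/
theorem oct12_seam (a : Oct12Sym → ℤ) (σ : Fin 12 → Fin 2) :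
    (16 : ℂ) • (algOp (oct12SymRep 2) (tableOfInt 16 a) *ᵥ Pi.single σ 1) =
      colVec 12 (orbitVec 12 (oct12GList a) (encodeBits σ)) := by
  have h16 := natCast_smul_sum_table_mulVec (fun g => oct12SymRep 2 g) 16 (by norm_num) a (Pi.single σ 1)
  unfold algOp tableOfInt
  rw [show (16 : ℂ) = ((16 : ℕ) : ℂ) by norm_num, h16]
  funext τ
  rw [Finset.sum_apply, sum_eq_oct12Elems_sum]
  simp only [colVec, evalSV_orbitVec, oct12GList, List.map_map]
  rw [Int.cast_list_sum, List.map_map]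
  congr 1
  refine List.map_congr_left fun g _ => ?_
  simp only [Function.comp_apply, Pi.smul_apply, smul_eq_mul, oct12SymRep_mulVec_single_act, actBits_oct12, encodeBits_inj]
  by_cases h : oct12Act g σ = τ
  · rw [if_pos h, h, Pi.single_eq_same, mul_one]
  · rw [if_neg h, Pi.single_eq_of_ne (Ne.symm h), mul_zero, Int.cast_zero]

end Oct12Seam

end Summit.HubbardSuperconductivity.HubbardLadder.ClusterCut
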